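import Mathlib
import Summits.Ventures.PercRepro2.CoinChainMixLsm
import Summits.Ventures.PercRepro2.CoinChainWorld1
import Summits.Ventures.PercRepro2.CoinChainMixedCentre

/-!
# The world-1 gate of the AND-switch chain centred at two different chain `R`-means
(blind cell PercRepro2, night-2 g22; proofs/NIGHT2-DARC.md §62)

`chain_world1_mixed_nonneg`: for the chain `R_ρ = ν · chainMix ent ent' ρ c d` and its world-1
gate `G₁ = ν · chainMix ent ent' 1 c d'`, and ANY two coin probabilities `ρ₁, ρ₂ ∈ [0, 1]`, the
cleared functional of `G₁` with the `x`-centre from `R_{ρ₁}` and the `y`-centre from `R_{ρ₂}` is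
nonnegative (nonnegative increasing markers) — `gate_functional_nonneg_mixed` with the entry set
`ent ∪ ent'`: `mixture_lsm` for the three laws, `chain_cross_holley` at `ρ₁` and at `ρ₂` for the
two Holley comparisons, `chainMix_of_not_meet` for the equalities off the entries.  At
`ρ₁ = ρ₂ = ρ` this is `chain_world1_nonneg` (for general markers); at `(ρ₁, ρ₂) = (1, 0)` and
`(0, 1)` it is the two mixed terms `U(1,0,1)`, `U(0,1,1)` of the Bernstein form of the chain's
cubic `T(ρ)` (§62.2).
-/

namespace Summit.Ventures.PercRepro2.Coin

open Classical

section MixedChain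

variable {V : Type*} [DecidableEq V] {R : Type*} [Field R] [LinearOrder R] [IsStrictOrderedRing R]

/-- **THE WORLD-1 GATE OF THE CHAIN CENTRED AT TWO DIFFERENT CHAIN `R`-MEANS.** For the AND-switch
chain (`R_ρ = ν · chainMix ent ent' ρ c d`, world-1 gate `G₁ = ν · chainMix ent ent' 1 c d'`) and
any two coin probabilities `ρ₁, ρ₂ ∈ [0, 1]`, the cleared functional of the world-1 gate with the
`x`-centre taken from `R_{ρ₁}` and the `y`-centre from `R_{ρ₂}` is nonnegative, for every pair of
nonnegative increasing markers — `gate_functional_nonneg_mixed` with the entry set `ent ∪ ent'`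
(`mixture_lsm` three times, `chain_cross_holley` twice, `chainMix_of_not_meet`). -/
theorem chain_world1_mixed_nonneg (U ent ent' : Finset V) (ν c d d' : Finset V → R)
    (ρ₁ ρ₂ : R) (hρ₁0 : 0 ≤ ρ₁) (hρ₁1 : ρ₁ ≤ 1) (hρ₂0 : 0 ≤ ρ₂) (hρ₂1 : ρ₂ ≤ 1)
    (hν0 : ∀ W, 0 ≤ ν W)
    (hν : ∀ s ⊆ U, ∀ t ⊆ U, ν s * ν t ≤ ν (s ∩ t) * ν (s ∪ t))
    (hc0 : ∀ W, 0 ≤ c W) (hd0 : ∀ W, 0 ≤ d W) (hd'0 : ∀ W, 0 ≤ d' W)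
    (hdc : ∀ W, d W ≤ c W) (hd'c : ∀ W, d' W ≤ c W)
    (hcc : ∀ s t, c s * c t ≤ c (s ∩ t) * c (s ∪ t))
    (hdd : ∀ s t, d s * d t ≤ d (s ∩ t) * d (s ∪ t))
    (hd'd' : ∀ s t, d' s * d' t ≤ d' (s ∩ t) * d' (s ∪ t))
    (hcd : ∀ s t, c s * d t ≤ c (s ∩ t) * d (s ∪ t))
    (hcd' : ∀ s t, c s * d' t ≤ c (s ∩ t) * d' (s ∪ t))
    (hdd' : ∀ s t, d s * d' t ≤ d (s ∩ t) * d' (s ∪ t))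
    (hratio : ∀ s t, s ⊆ t → d s * c t ≤ c s * d t)
    (hratio' : ∀ s t, s ⊆ t → d' s * c t ≤ c s * d' t)
    (x y : Finset V → R) (hx0 : ∀ W, 0 ≤ x W) (hy0 : ∀ W, 0 ≤ y W)
    (hxm : ∀ s t, x s ≤ x (s ∪ t)) (hym : ∀ s t, y s ≤ y (s ∪ t)) :
    0 ≤ (∑ W ∈ U.powerset, ν W * chainMix ent ent' ρ₁ c d W) *
          (∑ W ∈ U.powerset, ν W * chainMix ent ent' ρ₂ c d W) *
          (∑ W ∈ U.powerset, ν W * chainMix ent ent' 1 c d' W * (x W * y W))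
        - (∑ W ∈ U.powerset, ν W * chainMix ent ent' ρ₁ c d W) *
          (∑ W ∈ U.powerset, ν W * chainMix ent ent' ρ₂ c d W * y W) *
          (∑ W ∈ U.powerset, ν W * chainMix ent ent' 1 c d' W * x W)
        - (∑ W ∈ U.powerset, ν W * chainMix ent ent' ρ₂ c d W) *
          (∑ W ∈ U.powerset, ν W * chainMix ent ent' ρ₁ c d W * x W) *
          (∑ W ∈ U.powerset, ν W * chainMix ent ent' 1 c d' W * y W)
        + (∑ W ∈ U.powerset, ν W * chainMix ent ent' ρ₁ c d W * x W) *
          (∑ W ∈ U.powerset, ν W * chainMix ent ent' ρ₂ c d W * y W) *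
          (∑ W ∈ U.powerset, ν W * chainMix ent ent' 1 c d' W) := by
  set Gx : Finset V → R := fun W => ν W * chainMix ent ent' ρ₁ c d W with hGxdef
  set Gy : Finset V → R := fun W => ν W * chainMix ent ent' ρ₂ c d W with hGydef
  set G' : Finset V → R := fun W => ν W * chainMix ent ent' 1 c d' W with hG'def
  have hmx0 : ∀ W, 0 ≤ chainMix ent ent' ρ₁ c d W := chainMix_nonneg ent ent' hρ₁0 hρ₁1 hc0 hd0
  have hmy0 : ∀ W, 0 ≤ chainMix ent ent' ρ₂ c d W := chainMix_nonneg ent ent' hρ₂0 hρ₂1 hc0 hd0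
  have hm'0 : ∀ W, 0 ≤ chainMix ent ent' 1 c d' W :=
    chainMix_nonneg ent ent' (by norm_num) (le_refl 1) hc0 hd'0
  have hGx0 : ∀ W, 0 ≤ Gx W := fun W => mul_nonneg (hν0 W) (hmx0 W)
  have hGy0 : ∀ W, 0 ≤ Gy W := fun W => mul_nonneg (hν0 W) (hmy0 W)
  have hG'0 : ∀ W, 0 ≤ G' W := fun W => mul_nonneg (hν0 W) (hm'0 W)
  have hmixx := mixture_lsm ent ent' ρ₁ hρ₁0 hρ₁1 c d hc0 hd0 hdc hcc hdd hcd hratio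
  have hmixy := mixture_lsm ent ent' ρ₂ hρ₂0 hρ₂1 c d hc0 hd0 hdc hcc hdd hcd hratio
  have hmix' := mixture_lsm ent ent' 1 (by norm_num) (le_refl 1) c d' hc0 hd'0 hd'c hcc hd'd' hcd'
    hratio'
  have wLLx : ∀ s ⊆ U, ∀ t ⊆ U, Gx s * Gx t ≤ Gx (s ∩ t) * Gx (s ∪ t) := by
    intro s hs t ht
    simp only [hGxdef]
    calc ν s * chainMix ent ent' ρ₁ c d s * (ν t * chainMix ent ent' ρ₁ c d t)
        = (ν s * ν t) * (chainMix ent ent' ρ₁ c d s * chainMix ent ent' ρ₁ c d t) := by ring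
      _ ≤ (ν (s ∩ t) * ν (s ∪ t)) *
            (chainMix ent ent' ρ₁ c d (s ∩ t) * chainMix ent ent' ρ₁ c d (s ∪ t)) :=
          mul_le_mul (hν s hs t ht) (hmixx s t) (mul_nonneg (hmx0 _) (hmx0 _))
            (mul_nonneg (hν0 _) (hν0 _))
      _ = _ := by ring
  have wLLy : ∀ s ⊆ U, ∀ t ⊆ U, Gy s * Gy t ≤ Gy (s ∩ t) * Gy (s ∪ t) := by
    intro s hs t ht
    simp only [hGydef]
    calc ν s * chainMix ent ent' ρ₂ c d s * (ν t * chainMix ent ent' ρ₂ c d t)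
        = (ν s * ν t) * (chainMix ent ent' ρ₂ c d s * chainMix ent ent' ρ₂ c d t) := by ring
      _ ≤ (ν (s ∩ t) * ν (s ∪ t)) *
            (chainMix ent ent' ρ₂ c d (s ∩ t) * chainMix ent ent' ρ₂ c d (s ∪ t)) :=
          mul_le_mul (hν s hs t ht) (hmixy s t) (mul_nonneg (hmy0 _) (hmy0 _))
            (mul_nonneg (hν0 _) (hν0 _))
      _ = _ := by ring
  have wMM : ∀ s ⊆ U, ∀ t ⊆ U, G' s * G' t ≤ G' (s ∩ t) * G' (s ∪ t) := by
    intro s hs t ht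
    simp only [hG'def]
    calc ν s * chainMix ent ent' 1 c d' s * (ν t * chainMix ent ent' 1 c d' t)
        = (ν s * ν t) * (chainMix ent ent' 1 c d' s * chainMix ent ent' 1 c d' t) := by ring
      _ ≤ (ν (s ∩ t) * ν (s ∪ t)) *
            (chainMix ent ent' 1 c d' (s ∩ t) * chainMix ent ent' 1 c d' (s ∪ t)) :=
          mul_le_mul (hν s hs t ht) (hmix' s t) (mul_nonneg (hm'0 _) (hm'0 _))
            (mul_nonneg (hν0 _) (hν0 _))
      _ = _ := by ring
  have wMLx : ∀ s ⊆ U, ∀ t ⊆ U, (∃ r ∈ ent ∪ ent', r ∈ s) →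
      G' s * Gx t ≤ Gx (s ∩ t) * G' (s ∪ t) := by
    intro s hs t ht hse
    have hsu : ∃ r ∈ ent ∪ ent', r ∈ s ∪ t := by
      obtain ⟨r, hr, hrs⟩ := hse; exact ⟨r, hr, Finset.mem_union_left _ hrs⟩
    simp only [hGxdef, hG'def]
    rw [chainMix_one_of_meet ent ent' c d' hse, chainMix_one_of_meet ent ent' c d' hsu]
    calc ν s * d' s * (ν t * chainMix ent ent' ρ₁ c d t)
        = (ν s * ν t) * (d' s * chainMix ent ent' ρ₁ c d t) := by ring
      _ ≤ (ν (s ∩ t) * ν (s ∪ t)) * (chainMix ent ent' ρ₁ c d (s ∩ t) * d' (s ∪ t)) :=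
          mul_le_mul (hν s hs t ht)
            (chain_cross_holley ent ent' ρ₁ hρ₁0 hρ₁1 c d d' hdc hcd' hdd' hd'0 s t)
            (mul_nonneg (hd'0 _) (hmx0 _)) (mul_nonneg (hν0 _) (hν0 _))
      _ = _ := by ring
  have wMLy : ∀ s ⊆ U, ∀ t ⊆ U, (∃ r ∈ ent ∪ ent', r ∈ s) →
      G' s * Gy t ≤ Gy (s ∩ t) * G' (s ∪ t) := by
    intro s hs t ht hse
    have hsu : ∃ r ∈ ent ∪ ent', r ∈ s ∪ t := by
      obtain ⟨r, hr, hrs⟩ := hse; exact ⟨r, hr, Finset.mem_union_left _ hrs⟩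
    simp only [hGydef, hG'def]
    rw [chainMix_one_of_meet ent ent' c d' hse, chainMix_one_of_meet ent ent' c d' hsu]
    calc ν s * d' s * (ν t * chainMix ent ent' ρ₂ c d t)
        = (ν s * ν t) * (d' s * chainMix ent ent' ρ₂ c d t) := by ring
      _ ≤ (ν (s ∩ t) * ν (s ∪ t)) * (chainMix ent ent' ρ₂ c d (s ∩ t) * d' (s ∪ t)) :=
          mul_le_mul (hν s hs t ht)
            (chain_cross_holley ent ent' ρ₂ hρ₂0 hρ₂1 c d d' hdc hcd' hdd' hd'0 s t)
            (mul_nonneg (hd'0 _) (hmy0 _)) (mul_nonneg (hν0 _) (hν0 _))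
      _ = _ := by ring
  have hno : ∀ W : Finset V, W ∩ (ent ∪ ent') = ∅ → ¬ ∃ r ∈ ent ∪ ent', r ∈ W := by
    intro W hW
    rintro ⟨r, hr, hrW⟩
    have : r ∈ W ∩ (ent ∪ ent') := Finset.mem_inter.mpr ⟨hrW, hr⟩
    rw [hW] at this
    exact Finset.notMem_empty r this
  have hIx : ∀ W, W ∩ (ent ∪ ent') = ∅ → G' W = Gx W := by
    intro W hW
    simp only [hGxdef, hG'def]
    rw [chainMix_of_not_meet ent ent' ρ₁ c d (hno W hW), chainMix_of_not_meet ent ent' 1 c d' (hno W hW)]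
  have hIy : ∀ W, W ∩ (ent ∪ ent') = ∅ → G' W = Gy W := by
    intro W hW
    simp only [hGydef, hG'def]
    rw [chainMix_of_not_meet ent ent' ρ₂ c d (hno W hW), chainMix_of_not_meet ent ent' 1 c d' (hno W hW)]
  exact gate_functional_nonneg_mixed U (ent ∪ ent') Gx Gy G' x y hGx0 hGy0 hG'0 hx0 hy0 hxm hym
    wLLx wLLy wMM wMLx wMLy hIx hIy

end MixedChain

end Summit.Ventures.PercRepro2.Coin
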